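import Literature.NumberTheory.Transcendental.GammaIsoTwistedSteps
import Literature.NumberTheory.Transcendental.GammaAbsorption
import HarnessLib

/-!
# Twisted Γ-isomorphisms: absorbing the relative algebraic closure

Companion of `GammaIsoTwistedSteps.lean`: the twisted (two-base, over an isomorphism `σ` of base
Γ-fields) form of `GammaAbsorption.lean` (M. Bays, J. Kirby, *Pseudo-exponential maps, variants,
and quasiminimality*, Algebra & Number Theory 12 (2018), proof of Lemma 8.3 / Prop. 11.2: "we may
assume `A^full ∧ B = A`"), needed for Kirby 2010, Thm 2.1 = `IsZilberField.eclIso_extension`.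

* `IsGammaIsoTw.exists_append_of_forall_mem_acl` — extending a twisted Γ-isomorphism along a
  tuple of elements algebraic over the Γ-field of the base (the algebraic step iterated,
  Lemma 3.26 / Lemma 4.8);
* `GammaField.exists_absorb_tw` — absorbing the relative algebraic closure into the base while
  keeping all dimension data (twisted form of `GammaField.exists_absorb`).

The proofs are those of `GammaAbsorption.lean`; only the isomorphism bookkeeping is twisted.
Everything here is proved.

## References

* M. Bays, J. Kirby, *Pseudo-exponential maps, variants, and quasiminimality*, Algebra & Number
  Theory 12 (2018) 493–549: Lemma 3.26, Lemma 4.8, Cor. 7.4, Lemma 8.3 (proof), Prop. 11.2.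
* J. Kirby, *On quasiminimal excellent classes*, J. Symbolic Logic 75 (2010): Thm 2.1.
-/

noncomputable section

open Set

universe u

namespace Literature.NumberTheory.Transcendental

namespace GammaField

open Literature.ModelTheory.ExponentialFields.ExponentialRing ZilberSaturationMain
  Literature.FieldTheory.Regular

variable {F : Type u} [Field F] [CharZero F] [Literature.ModelTheory.ExponentialFields.ExponentialRing F]
variable {K₁ K₂ : Submodule ℚ F} {σ : fieldOf K₁ ≃+* fieldOf K₂} {n : ℕ}

/-! ### Iterated algebraic steps over `σ` -/

/-- **Extending a twisted Γ-isomorphism along a tuple of algebraic elements** (Lemma 3.26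
iterated, over `σ`): if `c ↦ c'` is a Γ-isomorphism over `σ` between strong bases and `x̄` is
linearly independent over `K₁ + ℚc` with every `x̄ⱼ` algebraic over `Γ(K₁ + ℚc)`, there is `x̄'`
with `(c, x̄) ↦ (c', x̄')` a Γ-isomorphism over `σ` and `K₂ + ℚc' + ℚx̄' ◁ F`.
[cite: BaysKirby2018ANT, Lemma 3.26, Lemma 4.8] -/
theorem IsGammaIsoTw.exists_append_of_forall_mem_acl [IsAlgClosed F] (hσ : IsEBaseIso K₁ K₂ σ) :
    ∀ {s N : ℕ} {c c' : Fin N → F} (_h : IsGammaIsoTw σ c c')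
      (_hs : IsStrong (K₁ ⊔ Submodule.span ℚ (range c)))
      (_hs' : IsStrong (K₂ ⊔ Submodule.span ℚ (range c'))) (x : Fin s → F),
      (∀ j, x j ∈ acl (gens (K₁ ⊔ Submodule.span ℚ (range c)))) →
      LinIndepOver (K₁ ⊔ Submodule.span ℚ (range c)) x →
      ∃ x' : Fin s → F, IsGammaIsoTw σ (Fin.append c x) (Fin.append c' x') ∧
        IsStrong (K₂ ⊔ Submodule.span ℚ (range (Fin.append c' x')))
  | 0, N, c, c', h, hs, hs', x, _, _ => by
    refine ⟨Fin.elim0, ?_, ?_⟩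
    · have hx : x = Fin.elim0 := funext fun i => i.elim0
      rw [hx, Fin.append_elim0, Fin.append_elim0]
      exact h.comp (Fin.cast (Nat.add_zero N))
    · rw [Fin.append_elim0]
      have : range (c' ∘ Fin.cast (Nat.add_zero N)) = range c' := by
        ext z
        constructor
        · rintro ⟨j, rfl⟩; exact ⟨_, rfl⟩
        · rintro ⟨j, rfl⟩; exact ⟨Fin.cast (Nat.add_zero N).symm j, by simp⟩
      rw [this]
      exact hs'
  | s + 1, N, c, c', h, hs, hs', x, hacl, hind => by
    obtain ⟨x₀', h₀, hs₀'⟩ := IsGammaIsoTw.exists_append_of_forall_mem_acl hσ h hs hs' (x ∘ Fin.castSucc)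
      (fun j => hacl _) (fun q hq => by
        have := hind (Fin.snoc q 0) (by
          rw [Fin.sum_univ_castSucc]
          simpa only [Fin.snoc_castSucc, Fin.snoc_last, zero_smul, add_zero, Function.comp_apply] using hq)
        funext j
        have hj := congrFun this j.castSucc
        simpa only [Fin.snoc_castSucc, Pi.zero_apply] using hj)
    have hs₀ : IsStrong (K₁ ⊔ Submodule.span ℚ (range (Fin.append c (x ∘ Fin.castSucc)))) := by
      rw [ZilberHomogeneity.range_append, Submodule.span_union, ← sup_assoc]
      exact hs.sup_span_of_forall_mem_acl _ fun j => hacl _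
    have hxl : x (Fin.last s) ∈ acl (gens (K₁ ⊔ Submodule.span ℚ (range (Fin.append c (x ∘ Fin.castSucc))))) :=
      acl_mono (gens_mono (by
        rw [ZilberHomogeneity.range_append, Submodule.span_union, ← sup_assoc]; exact le_sup_left)) (hacl _)
    have hxlX : x (Fin.last s) ∉ K₁ ⊔ Submodule.span ℚ (range (Fin.append c (x ∘ Fin.castSucc))) := by
      rw [ZilberHomogeneity.range_append, Submodule.span_union, ← sup_assoc]
      exact hind.last_notMem
    obtain ⟨xl', hacl', hnot', hγ⟩ := h₀.exists_append_single_of_mem_acl hσ hs₀ hs₀' hxl hxlX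
    refine ⟨Fin.snoc x₀' xl', ?_, ?_⟩
    · rw [append_eq_append_append_single c x, append_eq_append_append_single c']
      simpa only [Fin.snoc_last, Fin.init_snoc, show (Fin.snoc x₀' xl' ∘ Fin.castSucc) = x₀' from
        funext fun i => Fin.snoc_castSucc (α := fun _ => F) _ _ i] using hγ
    · rw [append_eq_append_append_single c', sup_span_range_append_single]
      simp only [Fin.snoc_last, show (Fin.snoc x₀' xl' ∘ Fin.castSucc) = x₀' from
        funext fun i => Fin.snoc_castSucc (α := fun _ => F) _ _ i]
      exact isStrong_sup_span_singleton_of_mem_acl hs₀' hacl' hnot'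

/-! ### The absorption over `σ` -/

/-- **Absorbing the relative algebraic closure, over `σ`** (twisted form of
`GammaField.exists_absorb`). Let `c ↦ c'` be a Γ-isomorphism over `σ` (an isomorphism of base
Γ-fields) between strong bases, `u` a basis (linearly independent over `A = K₁ + ℚc`) of a
Γ-algebraic extension (`td(u/A) = n`) such that every element of `B = A + ℚu` algebraic over
`Γ(A)` lies in `A`. Then there are `x̄`, algebraic over `Γ(A)` and linearly independent over `B`,
and `x̄'` with: `(c, x̄) ↦ (c', x̄')` a Γ-isomorphism over `σ`; `K₁ + ℚc + ℚx̄ ◁ F` and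
`K₂ + ℚc' + ℚx̄' ◁ F`; `u` linearly independent over `K₁ + ℚc + ℚx̄` with `td(u/K₁ + ℚc + ℚx̄) = n`;
and the Γ-field `⟨K₁ c x̄⟩` relatively algebraically closed in `⟨K₁ c x̄⟩(u, exp u)`.
[cite: BaysKirby2018ANT, Lemma 8.3 (proof: "we may assume `A^full ∧ B = A`"), Cor. 7.4, Prop. 11.2] -/
theorem exists_absorb_tw [IsAlgClosed F] {N : ℕ} {c c' : Fin N → F} (hiso : IsGammaIsoTw σ c c')
    (hσ : IsEBaseIso K₁ K₂ σ)
    (hs : IsStrong (K₁ ⊔ Submodule.span ℚ (range c)))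
    (hs' : IsStrong (K₂ ⊔ Submodule.span ℚ (range c'))) {u : Fin n → F}
    (hu : LinIndepOver (K₁ ⊔ Submodule.span ℚ (range c)) u)
    (htd : td (K₁ ⊔ Submodule.span ℚ (range c)) (Submodule.span ℚ (range u)) = n)
    (hcase : ∀ z ∈ (K₁ ⊔ Submodule.span ℚ (range c)) ⊔ Submodule.span ℚ (range u),
      z ∈ acl (gens (K₁ ⊔ Submodule.span ℚ (range c))) → z ∈ K₁ ⊔ Submodule.span ℚ (range c)) :
    ∃ (s : ℕ) (x x' : Fin s → F),
      IsGammaIsoTw σ (Fin.append c x) (Fin.append c' x') ∧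
      (∀ j, x j ∈ acl (gens (K₁ ⊔ Submodule.span ℚ (range c)))) ∧
      LinIndepOver ((K₁ ⊔ Submodule.span ℚ (range c)) ⊔ Submodule.span ℚ (range u)) x ∧
      IsStrong (K₁ ⊔ Submodule.span ℚ (range (Fin.append c x))) ∧
      IsStrong (K₂ ⊔ Submodule.span ℚ (range (Fin.append c' x'))) ∧
      LinIndepOver (K₁ ⊔ Submodule.span ℚ (range (Fin.append c x))) u ∧
      td (K₁ ⊔ Submodule.span ℚ (range (Fin.append c x))) (Submodule.span ℚ (range u)) = n ∧
      ∀ z ∈ IntermediateField.adjoin (fieldOf K₁) (allGens (Fin.append c x) ∪ range (gammaPt u)),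
        IsAlgebraic (bfld K₁ (Fin.append c x)) z → z ∈ bfld K₁ (Fin.append c x) := by
  classical
  have hfg : (IntermediateField.adjoin (bfld K₁ c) (range (gammaPt u))).FG :=
    ⟨Finset.univ.image (gammaPt u), by rw [Finset.coe_image, Finset.coe_univ, image_univ]⟩
  obtain ⟨s₀, hs₀Ω, hs₀alg, hclos⟩ := exists_finset_isAlgClosedIn_of_fg _ hfg
  set y : Fin s₀.card → F := fun i => (s₀.equivFin.symm i : F) with hy
  have hys₀ : ∀ i, y i ∈ s₀ := fun i => (s₀.equivFin.symm i).2
  obtain ⟨s, ρ, hxind, hspan⟩ := exists_linIndepOver_comp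
    ((K₁ ⊔ Submodule.span ℚ (range c)) ⊔ Submodule.span ℚ (range u)) y
  have hxalg : ∀ j, IsAlgebraic (bfld K₁ c) ((y ∘ ρ) j) := fun j => hs₀alg _ (hys₀ _)
  have hxacl : ∀ j, (y ∘ ρ) j ∈ acl (gens (K₁ ⊔ Submodule.span ℚ (range c))) := fun j =>
    acl_subset_acl_of_subset (coe_bfld_subset_acl K₁ c) (mem_acl_coe_of_isAlgebraic _ (hxalg j))
  have hxA : LinIndepOver (K₁ ⊔ Submodule.span ℚ (range c)) (y ∘ ρ) := hxind.of_le le_sup_left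
  obtain ⟨x', hγ, hstrong'⟩ := hiso.exists_append_of_forall_mem_acl hσ hs hs' (y ∘ ρ) hxacl hxA
  have hrange : K₁ ⊔ Submodule.span ℚ (range (Fin.append c (y ∘ ρ))) =
      (K₁ ⊔ Submodule.span ℚ (range c)) ⊔ Submodule.span ℚ (range (y ∘ ρ)) := by
    rw [ZilberHomogeneity.range_append, Submodule.span_union, ← sup_assoc]
  have hstrong : IsStrong (K₁ ⊔ Submodule.span ℚ (range (Fin.append c (y ∘ ρ)))) := by
    rw [hrange]; exact hs.sup_span_of_forall_mem_acl _ hxacl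
  have hu₂ : LinIndepOver (K₁ ⊔ Submodule.span ℚ (range (Fin.append c (y ∘ ρ)))) u := by
    rw [hrange]; exact hu.sup_span_of_linIndepOver_sup hxind
  have hfgu : IsFG (K₁ ⊔ Submodule.span ℚ (range c)) (Submodule.span ℚ (range u)) :=
    isFG_span_of_finite _ (finite_range u)
  have hδu : predim (K₁ ⊔ Submodule.span ℚ (range c)) (Submodule.span ℚ (range u)) = 0 := by
    rw [predim, htd, ldim_span_eq_of_linIndepOver hu]; simp
  have hB : IsStrong ((K₁ ⊔ Submodule.span ℚ (range c)) ⊔ Submodule.span ℚ (range u)) :=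
    hs.of_predim_eq_zero le_sup_left (isFG_sup_left.2 hfgu) (by rwa [predim_sup_left])
  have hδxA : predim (K₁ ⊔ Submodule.span ℚ (range c)) (Submodule.span ℚ (range (y ∘ ρ))) = 0 := by
    refine le_antisymm (predim_span_chain_nonpos _ _ fun j => ?_)
      (isStrong_iff.1 hs _ (isFG_span_of_finite _ (finite_range _)))
    exact td_span_singleton_le_one_of_mem_acl (acl_mono (gens_mono le_sup_left) (hxacl j))
  have hδxB : predim ((K₁ ⊔ Submodule.span ℚ (range c)) ⊔ Submodule.span ℚ (range u))
      (Submodule.span ℚ (range (y ∘ ρ))) = 0 := by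
    refine le_antisymm (predim_span_chain_nonpos _ _ fun j => ?_)
      (isStrong_iff.1 hB _ (isFG_span_of_finite _ (finite_range _)))
    exact td_span_singleton_le_one_of_mem_acl
      (acl_mono (gens_mono (le_sup_left.trans le_sup_left)) (hxacl j))
  have htd₂ : td (K₁ ⊔ Submodule.span ℚ (range (Fin.append c (y ∘ ρ)))) (Submodule.span ℚ (range u)) = n := by
    rw [hrange]
    have hfg1 : IsFG (K₁ ⊔ Submodule.span ℚ (range c))
        ((K₁ ⊔ Submodule.span ℚ (range c)) ⊔ Submodule.span ℚ (range (y ∘ ρ)) ⊔ Submodule.span ℚ (range u)) := by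
      rw [sup_assoc]
      exact isFG_sup_left.2 ((isFG_span_of_finite _ (finite_range _)).sup hfgu)
    have hswap : (K₁ ⊔ Submodule.span ℚ (range c)) ⊔ Submodule.span ℚ (range (y ∘ ρ)) ⊔ Submodule.span ℚ (range u) =
        (K₁ ⊔ Submodule.span ℚ (range c)) ⊔ Submodule.span ℚ (range u) ⊔ Submodule.span ℚ (range (y ∘ ρ)) := by
      simp only [sup_assoc]
      rw [sup_comm (Submodule.span ℚ (range (y ∘ ρ)))]
    have e1 := predim_add (le_sup_left : K₁ ⊔ Submodule.span ℚ (range c) ≤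
        (K₁ ⊔ Submodule.span ℚ (range c)) ⊔ Submodule.span ℚ (range (y ∘ ρ)))
      (le_sup_left : (K₁ ⊔ Submodule.span ℚ (range c)) ⊔ Submodule.span ℚ (range (y ∘ ρ)) ≤
        (K₁ ⊔ Submodule.span ℚ (range c)) ⊔ Submodule.span ℚ (range (y ∘ ρ)) ⊔ Submodule.span ℚ (range u)) hfg1
    have e2 := predim_add (le_sup_left : K₁ ⊔ Submodule.span ℚ (range c) ≤
        (K₁ ⊔ Submodule.span ℚ (range c)) ⊔ Submodule.span ℚ (range u))
      (le_sup_left : (K₁ ⊔ Submodule.span ℚ (range c)) ⊔ Submodule.span ℚ (range u) ≤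
        (K₁ ⊔ Submodule.span ℚ (range c)) ⊔ Submodule.span ℚ (range u) ⊔ Submodule.span ℚ (range (y ∘ ρ)))
      (by rw [← hswap]; exact hfg1)
    rw [predim_sup_left, predim_sup_left, hδxA] at e1
    rw [predim_sup_left, predim_sup_left, hδu, hδxB, ← hswap] at e2
    have hδ2 : predim ((K₁ ⊔ Submodule.span ℚ (range c)) ⊔ Submodule.span ℚ (range (y ∘ ρ)))
        (Submodule.span ℚ (range u)) = 0 := by linarith
    have hld : ldim ((K₁ ⊔ Submodule.span ℚ (range c)) ⊔ Submodule.span ℚ (range (y ∘ ρ)))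
        (Submodule.span ℚ (range u)) = n := ldim_span_eq_of_linIndepOver (hrange ▸ hu₂)
    rw [predim, hld] at hδ2
    have hne : td ((K₁ ⊔ Submodule.span ℚ (range c)) ⊔ Submodule.span ℚ (range (y ∘ ρ)))
        (Submodule.span ℚ (range u)) ≠ ⊤ := td_ne_top (isFG_span_of_finite _ (finite_range u))
    rw [← ENat.coe_toNat hne]
    congr 1
    omega
  have hmemΩ₂ : ∀ z : F, z ∈ IntermediateField.adjoin (bfld K₁ c) (range (gammaPt u)) ↔
      z ∈ IntermediateField.adjoin (fieldOf K₁) (allGens c ∪ range (gammaPt u)) := by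
    intro z
    rw [← IntermediateField.mem_restrictScalars (fieldOf K₁), IntermediateField.adjoin_adjoin_left]
  have hAE : ∀ z ∈ K₁ ⊔ Submodule.span ℚ (range c), z ∈ bfld K₁ c := fun z hz => mem_adjoinField_of_mem_sup hz
  have hEeq : IntermediateField.adjoin (bfld K₁ c) (range (y ∘ ρ)) =
      IntermediateField.adjoin (bfld K₁ c) (↑s₀ : Set F) := by
    refine le_antisymm (IntermediateField.adjoin.mono _ _ _ ?_) (IntermediateField.adjoin_le_iff.2 ?_)
    · rintro _ ⟨j, rfl⟩; exact hys₀ _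
    · intro z hz
      have hzB : z ∈ (K₁ ⊔ Submodule.span ℚ (range c)) ⊔ Submodule.span ℚ (range u) ⊔
          Submodule.span ℚ (range (y ∘ ρ)) := by
        rw [hspan]
        obtain ⟨i, rfl⟩ : ∃ i, y i = z := ⟨s₀.equivFin ⟨z, hz⟩, by simp [hy]⟩
        exact Submodule.mem_sup_right (Submodule.subset_span ⟨i, rfl⟩)
      obtain ⟨β, hβ, w, hw, hsum⟩ := Submodule.mem_sup.1 hzB
      obtain ⟨r, rfl⟩ := (Submodule.mem_span_range_iff_exists_fun ℚ).1 hw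
      obtain ⟨a, ha, v, hv, hsum'⟩ := Submodule.mem_sup.1 hβ
      obtain ⟨q, rfl⟩ := (Submodule.mem_span_range_iff_exists_fun ℚ).1 hv
      have hint : IsIntegral (bfld K₁ c) (∑ i, q i • u i) := by
        have heq : ∑ i, q i • u i = z - a - ∑ i, r i • (y ∘ ρ) i := by
          rw [← hsum, ← hsum']; abel
        rw [heq]
        refine IsIntegral.sub (IsIntegral.sub (hs₀alg z hz).isIntegral ?_) ?_
        · exact (isAlgebraic_algebraMap (⟨a, hAE a ha⟩ : bfld K₁ c)).isIntegral
        · refine IsIntegral.sum _ fun i _ => ?_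
          rw [Rat.smul_def]
          have h1 : IsIntegral (bfld K₁ c) ((r i : ℚ) : F) := by
            have := isIntegral_algebraMap (R := bfld K₁ c) (A := F)
              (x := ⟨(r i : F), SubfieldClass.ratCast_mem _ _⟩)
            rwa [IntermediateField.algebraMap_apply] at this
          exact h1.mul (hxalg i).isIntegral
      have hqu : ∑ i, q i • u i ∈ K₁ ⊔ Submodule.span ℚ (range c) :=
        hcase _ (Submodule.mem_sup_right (Submodule.sum_mem _ fun i _ =>
          Submodule.smul_mem _ _ (Submodule.subset_span ⟨i, rfl⟩)))
          (acl_subset_acl_of_subset (coe_bfld_subset_acl K₁ c) (mem_acl_coe_of_isAlgebraic _ hint.isAlgebraic))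
      have hzeq : z = (a + ∑ i, q i • u i) + ∑ i, r i • (y ∘ ρ) i := by rw [hsum', hsum]
      rw [hzeq]
      refine add_mem ?_ (sum_mem fun i _ => ?_)
      · exact IntermediateField.algebraMap_mem _ (⟨_, hAE _ (add_mem ha hqu)⟩ : bfld K₁ c)
      · rw [Rat.smul_def]
        exact mul_mem (SubfieldClass.ratCast_mem _ _) (IntermediateField.subset_adjoin _ _ ⟨i, rfl⟩)
  have hrac₁ : ∀ z ∈ IntermediateField.adjoin (fieldOf K₁) ((allGens c ∪ range (y ∘ ρ)) ∪ range (gammaPt u)),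
      IsAlgebraic (IntermediateField.adjoin (fieldOf K₁) (allGens c ∪ range (y ∘ ρ))) z →
        z ∈ IntermediateField.adjoin (fieldOf K₁) (allGens c ∪ range (y ∘ ρ)) := by
    intro z hz halg
    have hL₁ : IntermediateField.adjoin (fieldOf K₁) (allGens c ∪ range (y ∘ ρ)) =
        (IntermediateField.adjoin (bfld K₁ c) (↑s₀ : Set F)).restrictScalars (fieldOf K₁) := by
      rw [← hEeq, IntermediateField.adjoin_adjoin_left]
    have hzΩ : z ∈ IntermediateField.adjoin (bfld K₁ c) (range (gammaPt u)) := by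
      rw [hmemΩ₂]
      refine (IntermediateField.adjoin_le_iff.2 ?_) hz
      refine union_subset (union_subset ?_ ?_) ?_
      · exact fun w hw => IntermediateField.subset_adjoin _ _ (Or.inl hw)
      · rintro _ ⟨j, rfl⟩; exact (hmemΩ₂ _).1 (hs₀Ω (hys₀ _))
      · exact fun w hw => IntermediateField.subset_adjoin _ _ (Or.inr hw)
    have halg' := isAlgebraic_of_intermediateField_eq hL₁ halg
    have hmem := hclos z hzΩ halg'
    rw [hL₁, IntermediateField.mem_restrictScalars]
    exact hmem
  have hrac := isAlgClosedIn_adjoinField_allGens_append (K := K₁) hB hxacl hxind hrac₁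
  exact ⟨s, y ∘ ρ, x', hγ, hxacl, hxind, hstrong, hstrong', hu₂, htd₂, hrac⟩

end GammaField

end Literature.NumberTheory.Transcendental
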